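import Summits.NavierStokesRegularity.NavierStokesRegularity.Theses.AxisymmetricExtremality
import Summits.NavierStokesRegularity.NavierStokesRegularity.Theorems.AxisymmetricExtremalityAxisymmetricKatoGlobalStubSereginLogSwirlOriginStep3LocalBalance
import Summits.NavierStokesRegularity.NavierStokesRegularity.Theorems.AxisymmetricExtremalityAxisymmetricKatoGlobalStubSereginLogSwirlOriginStep3LocalEquationsPhi
import Summits.NavierStokesRegularity.NavierStokesRegularity.Theorems.AxisymmetricExtremalityAxisymmetricKatoGlobalStubSereginLogSwirlOriginStep3Gamma
import Literature.Analysis.FluidPDE.NSLocalLerayFarFieldTrace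
import Literature.Analysis.FluidPDE.WholeSpaceIBP
import HarnessLib

/-!
# Seregin 2022, §2 Step 3 for the LOCAL smooth class (V): localisation of the a.e. time
# derivative to a neighbourhood of the cut-off, the transport term under a LOCAL divergence
# condition, and the fixed-time localised energy inequalities of `Γ`, `Φ` for a smooth
# axisymmetric slice — crux stmt-NavierStokesRegularity-15453
# (`AxisymmetricExtremality.AxisymmetricKatoGlobal`), line registered, support for stub `stub_sereginLogSwirlOrigin`

Support file (`--supports stmt-NavierStokesRegularity-15453`; theorems only, everything proved)
toward the registered stub `stub_sereginLogSwirlOrigin` = the named fact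
`Literature.Analysis.FluidPDE.seregin2022_logSwirl_regularAtOrigin` (G. Seregin, J. Math. Fluid
Mech. 24 (2022), Paper 27 = arXiv:2201.00153, §2), sequel of `…Step3LocalBalance` and
`…Step3LocalEquationsPhi`. In the port of Step 3 to the local Seregin–Zajaczkowski class the
solution enters through a cut-off globalisation `u = χV` (globally `C^∞` axisymmetric slices),
which solves the vorticity equation and is divergence free only on an open set `W ⊇ supp ζ`
(where `χ = 1`). Accordingly this file provides:

* `integral_cutoff_sq_add_le_of_forall_le_of_ae_on` (registered sub-goal) — the integrated
  localised energy inequality of `…Step3LocalBalance` with the a.e. time-derivative hypothesis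
  required only at the points of an open `W ⊇ K` (off `W` nothing: multiply `G`, `G'` by a
  smooth Urysohn function `θ = 1` near `K`, `= 0` off `W` — every integral of the statement
  carries a factor `ζ`, `∇ζ` or `q_ζ`, all vanishing off `K`);
* `integral_sq_mul_mul_fderiv_apply_of_divFreeOn` — the transport term
  `∫ ζ²G DG[b] = −∫ ζG² Dζ[b]` when `div b = 0` only where `ζ ≠ 0`
  (`∫ θ div b + ∫⟪b, ∇θ⟫ = 0` with `θ = (ζG)²`, `integral_mul_divergence_add_eq_zero_left`);
* `angVortQuot_cutoff_energy_le_local`, `radVelQuot_curl_cutoff_energy_le_local` — **the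
  fixed-time localised energy inequalities of Step 3 for a smooth axisymmetric SLICE `u`**
  (arXiv p. 6: "multiply the first equation by `Φη⁶` and the second by `Γη⁶`. After
  integration by parts …", with the axis terms dropped by sign as in `…Step3Gamma`), the
  time derivative rendered by the quotients `angVelQuot W`, `radVelQuot W` of the vorticity
  right-hand side `W = νΔω − Dω[u] + Du[ω]` (`…Step3LocalEquations(Phi)`:
  `angVelQuot W + DΓ[u] = ν(ΔΓ + 2q_Γ) − 2(u_θ/r)Φ`, `radVelQuot W + DΦ[u] = ν(ΔΦ + 2q_Φ) + D(u_r/r)[ω]`)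
  and `div u = 0` only where `ζ ≠ 0`:
  `∫ ζ²Γ (angVelQuot W) + ν∫|∇(ζΓ)|² ≤ ∫ ζΓ²Dζ[u] + ν∫Γ²|∇ζ|² − 2ν∫ζΓ²q_ζ − 2∫ζ²Γ(u_θ/r)Φ`,
  `∫ ζ²Φ (radVelQuot W) + ν∫|∇(ζΦ)|² ≤ ∫ ζΦ²Dζ[u] + ν∫Φ²|∇ζ|² − 2ν∫ζΦ²q_ζ + ∫ζ²Φ D(u_r/r)[ω]`
  (the generic `integral_cutoff_energy_le` with zero drift, then the local transport identity).
## Mathlib / tree search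

Tree: `integral_cutoff_energy_le` (`…Step3Gamma`), `integral_sq_mul_mul_fderiv_apply`
(`…Step3CutoffCalculus`, GLOBAL `div b = 0`), `integral_cutoff_sq_add_le_of_forall_le_of_ae`
(`…Step3LocalBalance`), `angVelQuot_vorticityRHS_eq`, `radVelQuot_vorticityRHS_eq`,
`contDiff_vorticityRHS` (`…Step3LocalEquations(Phi)`), `exists_contDiff_one_nhdsSet_zero_nhdsSet`
(`NSLocalLerayFarFieldTrace`), `integral_mul_divergence_add_eq_zero_left` (`WholeSpaceIBP`),
`fderiv_eq_zero_of_forall_notMem` (`…CutoffDivCurl`), `integrable_sq_mul_mul`,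
`fderiv_mul_apply_of_differentiableAt` (`…Step3CutoffCalculus`). Mathlib:
`InnerProductSpace.toDual_symm_apply` (`⟪∇θ, v⟫ = Dθ v`), `Filter.Eventually.self_of_nhdsSet`.
`lean search 'divFreeOn|cutoff_energy_le_local|_of_ae_on' --decl`: no matches (2026-08-17).

## References

* G. Seregin, J. Math. Fluid Mech. 24 (2022), Paper No. 27 = arXiv:2201.00153, §2 Step 3
  (arXiv pp. 6–7). [`Seregin2022LocalAxisym`]
-/

noncomputable section

open MeasureTheory Set Filter Topology Function intervalIntegral Metric InnerProductSpace
open scoped ENNReal ContDiff Laplacian RealInnerProductSpace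
open Literature.Analysis.FluidPDE

-- `<Problem> = <Summit>` duplicates a namespace component by design (lakefile sets the same option).
set_option linter.dupNamespace false

namespace Summit.NavierStokesRegularity.NavierStokesRegularity.Theorems.AxisymmetricKatoGlobal.EulerScaling

/-! ### The a.e. time derivative is needed only near the cut-off -/

section Localise

/-- **The integrated localised energy inequality with the a.e. time derivative of `G` required
only on an open neighbourhood `W` of the compact `K` off which `ζ` vanishes**: the statement of
`integral_cutoff_sq_add_le_of_forall_le_of_ae` (sibling `…Step3LocalBalance`) with its
hypothesis `d/ds G(s, x) = G'(s, x)` for a.e. `x` weakened to a.e. `x ∈ W`. Proof: apply the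
sibling to `θG`, `θG'` for a smooth `θ` with `θ = 1` near `K` and `θ = 0` off `W`; all integrals
are unchanged since each integrand has a factor `ζ`, `∂ᵢζ` or `q_ζ` supported in `K`. This is the
form used for the cut-off globalisation `χV` of the local smooth class, which solves the
vorticity equation only where `χ = 1`. Registered sub-goal toward `stub_sereginLogSwirlOrigin`.
[cite: Seregin2022LocalAxisym, §2 Step 3 (arXiv:2201.00153 p. 7, "the key estimate can be derived by more or less standard arguments")] -/
theorem integral_cutoff_sq_add_le_of_forall_le_of_ae_on : ∀ (S : Set ℝ) (ν : ℝ) (ζ G G' R : ℝ → EuclideanSpace ℝ (Fin 3) → ℝ) (b : ℝ → EuclideanSpace ℝ (Fin 3) → EuclideanSpace ℝ (Fin 3)) (K W : Set (EuclideanSpace ℝ (Fin 3))) (t₁ t₂ : ℝ), IsOpen S → Convex ℝ S → IsSmoothSpaceTimeOn S ζ → IsCompact K → (∀ t ∈ S, ∀ x ∉ K, ζ t x = 0) → IsOpen W → K ⊆ W → ContinuousOn (uncurry G) (S ×ˢ univ) → ContinuousOn (uncurry G') (S ×ˢ univ) → (∀ᵐ x ∂(volume : Measure (EuclideanSpace ℝ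 (Fin 3))), x ∈ W → ∀ s ∈ S, HasDerivAt (fun s' => G s' x) (G' s x) s) → (∀ t ∈ S, Differentiable ℝ (G t)) → ContinuousOn (fun z : ℝ × EuclideanSpace ℝ (Fin 3) => fderiv ℝ (G z.1) z.2) (S ×ˢ univ) → ContinuousOn (uncurry R) (S ×ˢ univ) → ContinuousOn (uncurry b) (S ×ˢ univ) → (∀ t ∈ S, (∫ x, ζ t x ^ 2 * G t x * G' t x) + ν * ∫ x, (fderiv ℝ (fun y => ζ t y * G t y) x (EuclideanSpace.single 0 1) ^ 2 + fderiv ℝ (fun y => ζ t y * G t y) x (EuclideanSpace.single 1 1) ^ 2 + fderiv ℝ (fun y => ζ t y * G t y) x (EuclideanSpace.single 2 1) ^ 2) ≤ (∫ x, ζ t x * G t x ^ 2 * fderiv ℝ (ζ t) x (b t x)) + ν * (∫ x, G t x ^ 2 * (fderiv ℝ (ζ t) x (EuclideanSpace.single 0 1) ^ 2 + fderiv ℝ (ζ t) x (EuclideanSpace.single 1 1) ^ 2 + fderiv ℝ (ζ t) x (EuclideanSpace.single 2 1) ^ 2)) - 2 * ν * (∫ x, ζ t x * G t x ^ 2 *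 radDerivQuot (ζ t) x) + ∫ x, ζ t x ^ 2 * G t x * R t x) → t₁ ≤ t₂ → Icc t₁ t₂ ⊆ S → (∫ x, (ζ t₂ x * G t₂ x) ^ 2) + 2 * ν * ∫ t in t₁..t₂, ∫ x, (fderiv ℝ (fun y => ζ t y * G t y) x (EuclideanSpace.single 0 1) ^ 2 + fderiv ℝ (fun y => ζ t y * G t y) x (EuclideanSpace.single 1 1) ^ 2 + fderiv ℝ (fun y => ζ t y * G t y) x (EuclideanSpace.single 2 1) ^ 2) ≤ (∫ x, (ζ t₁ x * G t₁ x) ^ 2) + ∫ t in t₁..t₂, (2 * (∫ x, ζ t x * timeDerivWithin S ζ t x * G t x ^ 2) + 2 * (∫ x, ζ t x * G t x ^ 2 * fderiv ℝ (ζ t) x (b t x)) + 2 * ν * (∫ x, G t x ^ 2 * (fderiv ℝ (ζ t) x (EuclideanSpace.single 0 1) ^ 2 + fderiv ℝ (ζ t) x (EuclideanSpace.single 1 1) ^ 2 + fderiv ℝ (ζ t) x (EuclideanSpace.single 2 1) ^ 2)) - 4 * ν * (∫ x, ζ t x * G t x ^ 2 * radDerivQuot (ζ t) x) + 2 * ∫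 x, ζ t x ^ 2 * G t x * R t x) := by
  intro S ν ζ G G' R b K W t₁ t₂ hS hc hζ hK hsupp hW hKW hG hG' hder hGd hDG hR hb hfix h12 hsub
  -- a smooth `θ` with `θ = 1` near `K`, `θ = 0` off `W`
  obtain ⟨θ, hθ, hθ1, hθ0⟩ := exists_contDiff_one_nhdsSet_zero_nhdsSet hK hW hKW
  have hθK : ∀ x ∈ K, θ x = 1 := fun x hx => hθ1.self_of_nhdsSet x hx
  have hθW : ∀ x ∉ W, θ x = 0 := fun x hx => hθ0.self_of_nhdsSet x hx
  have hθd : Differentiable ℝ θ := hθ.differentiable (by simp)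
  have hDθc : Continuous (fderiv ℝ θ) := hθ.continuous_fderiv (by simp)
  -- pointwise identities: every integrand has a factor supported in `K`
  have hDζ0 : ∀ s ∈ S, ∀ x ∉ K, fderiv ℝ (ζ s) x = 0 := fun s hs x hx =>
    fderiv_eq_zero_of_forall_notMem hK.isClosed (hsupp s hs) hx
  have eE : ∀ s ∈ S, ∀ y, ζ s y * (θ y * G s y) = ζ s y * G s y := by
    intro s hs y
    by_cases hy : y ∈ K
    · rw [hθK y hy, one_mul]
    · simp [hsupp s hs y hy]
  have e0 : ∀ s ∈ S, ∀ x, ζ s x * timeDerivWithin S ζ s x * (θ x * G s x) ^ 2 =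
      ζ s x * timeDerivWithin S ζ s x * G s x ^ 2 := by
    intro s hs x
    by_cases hx : x ∈ K
    · rw [hθK x hx, one_mul]
    · simp [hsupp s hs x hx]
  have e1 : ∀ s ∈ S, ∀ x, ζ s x * (θ x * G s x) ^ 2 * fderiv ℝ (ζ s) x (b s x) =
      ζ s x * G s x ^ 2 * fderiv ℝ (ζ s) x (b s x) := by
    intro s hs x
    by_cases hx : x ∈ K
    · rw [hθK x hx, one_mul]
    · simp [hsupp s hs x hx]
  have e2 : ∀ s ∈ S, ∀ x, (θ x * G s x) ^ 2 * (fderiv ℝ (ζ s) x (EuclideanSpace.single 0 1) ^ 2 +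
      fderiv ℝ (ζ s) x (EuclideanSpace.single 1 1) ^ 2 + fderiv ℝ (ζ s) x (EuclideanSpace.single 2 1) ^ 2) =
      G s x ^ 2 * (fderiv ℝ (ζ s) x (EuclideanSpace.single 0 1) ^ 2 +
        fderiv ℝ (ζ s) x (EuclideanSpace.single 1 1) ^ 2 + fderiv ℝ (ζ s) x (EuclideanSpace.single 2 1) ^ 2) := by
    intro s hs x
    by_cases hx : x ∈ K
    · rw [hθK x hx, one_mul]
    · simp [hDζ0 s hs x hx]
  have e3 : ∀ s ∈ S, ∀ x, ζ s x * (θ x * G s x) ^ 2 * radDerivQuot (ζ s) x =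
      ζ s x * G s x ^ 2 * radDerivQuot (ζ s) x := by
    intro s hs x
    by_cases hx : x ∈ K
    · rw [hθK x hx, one_mul]
    · simp [hsupp s hs x hx]
  have e4 : ∀ s ∈ S, ∀ x, ζ s x ^ 2 * (θ x * G s x) * R s x =
      ζ s x ^ 2 * G s x * R s x := by
    intro s hs x
    by_cases hx : x ∈ K
    · rw [hθK x hx, one_mul]
    · simp [hsupp s hs x hx]
  have e5 : ∀ s ∈ S, ∀ x, ζ s x ^ 2 * (θ x * G s x) * (θ x * G' s x) =
      ζ s x ^ 2 * G s x * G' s x := by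
    intro s hs x
    by_cases hx : x ∈ K
    · rw [hθK x hx, one_mul, one_mul]
    · simp [hsupp s hs x hx]
  -- hypotheses of the sibling for `θG`, `θG'`
  have hGt : ContinuousOn (uncurry fun s x => θ x * G s x) (S ×ˢ univ) :=
    ((hθ.continuous.comp continuous_snd).continuousOn.mul hG).congr fun z _ => rfl
  have hG't : ContinuousOn (uncurry fun s x => θ x * G' s x) (S ×ˢ univ) :=
    ((hθ.continuous.comp continuous_snd).continuousOn.mul hG').congr fun z _ => rfl
  have hdert : ∀ᵐ x ∂(volume : Measure (EuclideanSpace ℝ (Fin 3))), ∀ s ∈ S,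
      HasDerivAt (fun s' => θ x * G s' x) (θ x * G' s x) s := by
    filter_upwards [hder] with x hx s hs
    by_cases hxW : x ∈ W
    · exact (hx hxW s hs).const_mul (θ x)
    · simp only [hθW x hxW, zero_mul]
      exact hasDerivAt_const s 0
  have hGtd : ∀ t ∈ S, Differentiable ℝ fun x => θ x * G t x := fun t ht => hθd.mul (hGd t ht)
  have hDGt : ContinuousOn (fun z : ℝ × EuclideanSpace ℝ (Fin 3) =>
      fderiv ℝ (fun x => θ x * G z.1 x) z.2) (S ×ˢ univ) := by
    have h := (((hθ.continuous.comp continuous_snd).continuousOn).smul hDG).add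
      (hG.smul ((hDθc.comp continuous_snd).continuousOn))
    refine h.congr fun z hz => ?_
    have hz1 : z.1 ∈ S := hz.1
    exact fderiv_fun_mul (hθd z.2) (hGd z.1 hz1 z.2)
  have hfixt : ∀ t ∈ S, (∫ x, ζ t x ^ 2 * (θ x * G t x) * (θ x * G' t x)) + ν * ∫ x,
      (fderiv ℝ (fun y => ζ t y * (θ y * G t y)) x (EuclideanSpace.single 0 1) ^ 2 +
        fderiv ℝ (fun y => ζ t y * (θ y * G t y)) x (EuclideanSpace.single 1 1) ^ 2 +
        fderiv ℝ (fun y => ζ t y * (θ y * G t y)) x (EuclideanSpace.single 2 1) ^ 2) ≤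
      (∫ x, ζ t x * (θ x * G t x) ^ 2 * fderiv ℝ (ζ t) x (b t x)) +
      ν * (∫ x, (θ x * G t x) ^ 2 * (fderiv ℝ (ζ t) x (EuclideanSpace.single 0 1) ^ 2 +
        fderiv ℝ (ζ t) x (EuclideanSpace.single 1 1) ^ 2 + fderiv ℝ (ζ t) x (EuclideanSpace.single 2 1) ^ 2)) -
      2 * ν * (∫ x, ζ t x * (θ x * G t x) ^ 2 * radDerivQuot (ζ t) x) +
      ∫ x, ζ t x ^ 2 * (θ x * G t x) * R t x := by
    intro t ht
    simp only [e5 t ht, eE t ht, e1 t ht, e2 t ht, e3 t ht, e4 t ht]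
    exact hfix t ht
  have h := integral_cutoff_sq_add_le_of_forall_le_of_ae S ν ζ (fun s x => θ x * G s x)
    (fun s x => θ x * G' s x) R b K t₁ t₂ hS hc hζ hK hsupp hGt hG't hdert hGtd hDGt hR hb hfixt h12 hsub
  -- back to `G`
  have hI : ∀ t ∈ uIcc t₁ t₂, t ∈ S := fun t ht => hsub (by rwa [uIcc_of_le h12] at ht)
  simp only [eE t₁ (hsub ⟨le_rfl, h12⟩), eE t₂ (hsub ⟨h12, le_rfl⟩)] at h
  have hD : (∫ t in t₁..t₂, ∫ x,
      (fderiv ℝ (fun y => ζ t y * (θ y * G t y)) x (EuclideanSpace.single 0 1) ^ 2 +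
        fderiv ℝ (fun y => ζ t y * (θ y * G t y)) x (EuclideanSpace.single 1 1) ^ 2 +
        fderiv ℝ (fun y => ζ t y * (θ y * G t y)) x (EuclideanSpace.single 2 1) ^ 2)) =
      ∫ t in t₁..t₂, ∫ x,
      (fderiv ℝ (fun y => ζ t y * G t y) x (EuclideanSpace.single 0 1) ^ 2 +
        fderiv ℝ (fun y => ζ t y * G t y) x (EuclideanSpace.single 1 1) ^ 2 +
        fderiv ℝ (fun y => ζ t y * G t y) x (EuclideanSpace.single 2 1) ^ 2) :=
    intervalIntegral.integral_congr fun t ht => by simp only [eE t (hI t ht)]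
  have hRHS : (∫ t in t₁..t₂,
      (2 * (∫ x, ζ t x * timeDerivWithin S ζ t x * (θ x * G t x) ^ 2) +
        2 * (∫ x, ζ t x * (θ x * G t x) ^ 2 * fderiv ℝ (ζ t) x (b t x)) +
        2 * ν * (∫ x, (θ x * G t x) ^ 2 * (fderiv ℝ (ζ t) x (EuclideanSpace.single 0 1) ^ 2 +
          fderiv ℝ (ζ t) x (EuclideanSpace.single 1 1) ^ 2 + fderiv ℝ (ζ t) x (EuclideanSpace.single 2 1) ^ 2)) -
        4 * ν * (∫ x, ζ t x * (θ x * G t x) ^ 2 * radDerivQuot (ζ t) x) +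
        2 * ∫ x, ζ t x ^ 2 * (θ x * G t x) * R t x)) =
      ∫ t in t₁..t₂,
      (2 * (∫ x, ζ t x * timeDerivWithin S ζ t x * G t x ^ 2) +
        2 * (∫ x, ζ t x * G t x ^ 2 * fderiv ℝ (ζ t) x (b t x)) +
        2 * ν * (∫ x, G t x ^ 2 * (fderiv ℝ (ζ t) x (EuclideanSpace.single 0 1) ^ 2 +
          fderiv ℝ (ζ t) x (EuclideanSpace.single 1 1) ^ 2 + fderiv ℝ (ζ t) x (EuclideanSpace.single 2 1) ^ 2)) -
        4 * ν * (∫ x, ζ t x * G t x ^ 2 * radDerivQuot (ζ t) x) + 2 * ∫ x, ζ t x ^ 2 * G t x * R t x) :=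
    intervalIntegral.integral_congr fun t ht => by
      simp only [e0 t (hI t ht), e1 t (hI t ht), e2 t (hI t ht), e3 t (hI t ht), e4 t (hI t ht)]
  rwa [hD, hRHS] at h

end Localise

/-! ### The transport term under a local divergence condition -/

section Transport

variable {ζ G : EuclideanSpace ℝ (Fin 3) → ℝ} {b : EuclideanSpace ℝ (Fin 3) → EuclideanSpace ℝ (Fin 3)}

/-- **`∫ ζ²G DG[b] = −∫ ζG² Dζ[b]` when `div b = 0` wherever `ζ ≠ 0`** (`ζ ∈ C¹_c`, `G, b ∈ C¹`):
`∫ θ div b + ∫ ⟪b, ∇θ⟫ = 0` for `θ = (ζG)²` (`integral_mul_divergence_add_eq_zero_left`), the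
first integrand vanishing identically, and `Dθ[b] = 2ζ²G DG[b] + 2ζG² Dζ[b]`. The local form of
`integral_sq_mul_mul_fderiv_apply` needed for a cut-off globalisation `χV`, divergence free only
where `χ = 1`. [folklore] -/
theorem integral_sq_mul_mul_fderiv_apply_of_divFreeOn (hζ : ContDiff ℝ 1 ζ) (hζc : HasCompactSupport ζ)
    (hG : ContDiff ℝ 1 G) (hb : ContDiff ℝ 1 b)
    (hdiv : ∀ x, ζ x ≠ 0 → VectorCalculus.divergence b x = 0) :
    ∫ x, ζ x ^ 2 * G x * fderiv ℝ G x (b x) = -∫ x, ζ x * G x ^ 2 * fderiv ℝ ζ x (b x) := by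
  have hζd : Differentiable ℝ ζ := hζ.differentiable one_ne_zero
  have hGd : Differentiable ℝ G := hG.differentiable one_ne_zero
  have hF : ContDiff ℝ 1 fun y => (ζ y * G y) * (ζ y * G y) := (hζ.mul hG).mul (hζ.mul hG)
  have hFc : HasCompactSupport fun y => (ζ y * G y) * (ζ y * G y) :=
    (hζc.mul_right).mul_right
  have h0 := integral_mul_divergence_add_eq_zero_left hF hb hFc
  have hzero : ∫ x, (ζ x * G x) * (ζ x * G x) * VectorCalculus.divergence b x = 0 := by
    refine integral_eq_zero_of_ae (Eventually.of_forall fun x => ?_)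
    by_cases hx : ζ x = 0 <;> simp [hx, hdiv x]
  rw [hzero, zero_add] at h0
  have hpt : ∀ x, ⟪b x, gradient (fun y => (ζ y * G y) * (ζ y * G y)) x⟫ =
      2 * (ζ x ^ 2 * G x * fderiv ℝ G x (b x)) + 2 * (ζ x * G x ^ 2 * fderiv ℝ ζ x (b x)) := by
    intro x
    rw [real_inner_comm, gradient, InnerProductSpace.toDual_symm_apply,
      fderiv_mul_apply_of_differentiableAt ((hζd x).fun_mul (hGd x)) ((hζd x).fun_mul (hGd x)),
      fderiv_mul_apply_of_differentiableAt (hζd x) (hGd x)]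
    ring
  have hDb : Continuous fun x => fderiv ℝ G x (b x) := (hG.continuous_fderiv one_ne_zero).clm_apply hb.continuous
  have hDζb : Continuous fun x => fderiv ℝ ζ x (b x) := (hζ.continuous_fderiv one_ne_zero).clm_apply hb.continuous
  have i1 : Integrable (fun x => ζ x ^ 2 * G x * fderiv ℝ G x (b x)) :=
    integrable_sq_mul_mul hζ.continuous hζc hG.continuous hDb
  have i2 : Integrable (fun x => ζ x * G x ^ 2 * fderiv ℝ ζ x (b x)) :=
    ((hζ.continuous.mul (hG.continuous.pow 2)).mul hDζb).integrable_of_hasCompactSupport (hζc.mul_right).mul_right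
  rw [integral_congr_ae (Eventually.of_forall hpt), integral_add (i1.const_mul 2) (i2.const_mul 2),
    MeasureTheory.integral_const_mul, MeasureTheory.integral_const_mul] at h0
  linarith

end Transport

/-! ### The fixed-time localised energy inequalities of `Γ`, `Φ` for a smooth axisymmetric slice -/

section FixedTime

variable {u : EuclideanSpace ℝ (Fin 3) → EuclideanSpace ℝ (Fin 3)} {ζ : EuclideanSpace ℝ (Fin 3) → ℝ} {ν : ℝ}

/-- **Seregin 2022, §2 Step 3, the localised energy inequality of `Γ = ω_θ/r` at a fixed time,
for a smooth axisymmetric slice** (no solution class, no time): for an axisymmetric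
`u ∈ C^∞(ℝ³)` with `div u = 0` where `ζ ≠ 0`, an axisymmetric cut-off `ζ ∈ C²_c`, `ν ≥ 0`, and
the vorticity right-hand side `W = νΔω − Dω[u] + Du[ω]` (whose quotient `angVelQuot W` is `∂ₜΓ`
along a solution, `hasDerivAt_angVortQuot_of_ne`):
`∫ ζ²Γ (angVelQuot W) + ν∫|∇(ζΓ)|² ≤ ∫ ζΓ² Dζ[u] + ν∫ Γ²|∇ζ|² − 2ν∫ ζΓ² q_ζ − 2∫ ζ²Γ (u_θ/r) Φ`
(`Γ = angVortQuot u`, `Φ = radVelQuot (curl u)`, `u_θ/r = angVelQuot u`; the axis term dropped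
by sign). From `integral_cutoff_energy_le` with zero drift and `G' = angVelQuot W + DΓ[u]`
(the slice identity `angVelQuot_vorticityRHS_eq`), and the local transport identity.
[cite: Seregin2022LocalAxisym, §2 Step 3 (arXiv:2201.00153 p. 6, the identity for Γη⁶ with B₁, B₂, B₃)] -/
theorem angVortQuot_cutoff_energy_le_local (hu : ContDiff ℝ ∞ u) (hax : IsAxisymmetric u)
    (hν : 0 ≤ ν) (hζ : ContDiff ℝ 2 ζ) (hζax : IsAxisymmetricScalar ζ) (hζc : HasCompactSupport ζ)
    (hdiv : ∀ x, ζ x ≠ 0 → VectorCalculus.divergence u x = 0) :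
    (∫ x, ζ x ^ 2 * angVortQuot u x * angVelQuot (fun y => ν • (Δ (curl u)) y -
        fderiv ℝ (curl u) y (u y) + fderiv ℝ u y (curl u y)) x) +
      ν * ∫ x, (fderiv ℝ (fun y => ζ y * angVortQuot u y) x (EuclideanSpace.single 0 1) ^ 2 +
        fderiv ℝ (fun y => ζ y * angVortQuot u y) x (EuclideanSpace.single 1 1) ^ 2 +
        fderiv ℝ (fun y => ζ y * angVortQuot u y) x (EuclideanSpace.single 2 1) ^ 2) ≤
      (∫ x, ζ x * angVortQuot u x ^ 2 * fderiv ℝ ζ x (u x)) +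
      ν * (∫ x, angVortQuot u x ^ 2 * (fderiv ℝ ζ x (EuclideanSpace.single 0 1) ^ 2 +
        fderiv ℝ ζ x (EuclideanSpace.single 1 1) ^ 2 + fderiv ℝ ζ x (EuclideanSpace.single 2 1) ^ 2)) -
      2 * ν * (∫ x, ζ x * angVortQuot u x ^ 2 * radDerivQuot ζ x) -
      2 * ∫ x, ζ x ^ 2 * angVortQuot u x * (angVelQuot u x * radVelQuot (curl u) x) := by
  set W : EuclideanSpace ℝ (Fin 3) → EuclideanSpace ℝ (Fin 3) := fun y =>
    ν • (Δ (curl u)) y - fderiv ℝ (curl u) y (u y) + fderiv ℝ u y (curl u y) with hWdef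
  have hv1 : ContDiff ℝ 1 u := hu.of_le (by norm_cast)
  have hv3 : ContDiff ℝ 3 u := hu.of_le (by norm_cast)
  have hv4 : ContDiff ℝ 4 u := hu.of_le (by norm_cast)
  have hv5 : ContDiff ℝ 5 u := hu.of_le (by norm_cast)
  have hω : ContDiff ℝ ∞ (curl u) := contDiff_curl (n := ⊤) (by exact_mod_cast hu)
  have hω4 : ContDiff ℝ 4 (curl u) := hω.of_le (by norm_cast)
  have hW : ContDiff ℝ ∞ W := contDiff_vorticityRHS hu ν
  have hW4 : ContDiff ℝ 4 W := hW.of_le (by norm_cast)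
  have hΩ2 : ContDiff ℝ 2 (angVortQuot u) := contDiff_angVortQuot (n := 2) hv5
  have hΩ1 : ContDiff ℝ 1 (angVortQuot u) := hΩ2.of_le (by norm_num)
  have hΩax : IsAxisymmetricScalar (angVortQuot u) := hax.isAxisymmetricScalar_angVortQuot hv3
  have hΩ' : ContDiff ℝ 2 (angVelQuot W) := contDiff_angVelQuot (n := 2) hW4
  have hΦ : ContDiff ℝ 2 (angVelQuot u) := contDiff_angVelQuot (n := 2) hv4
  have hJ : ContDiff ℝ 2 (radVelQuot (curl u)) := contDiff_radVelQuot (n := 2) hω4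
  have hR : Continuous fun x => (-2) * (angVelQuot u x * radVelQuot (curl u) x) :=
    continuous_const.mul (hΦ.continuous.mul hJ.continuous)
  have hb0 : ContDiff ℝ 1 (0 : EuclideanSpace ℝ (Fin 3) → EuclideanSpace ℝ (Fin 3)) := contDiff_const
  have hdiv0 : VectorCalculus.IsDivFree (0 : EuclideanSpace ℝ (Fin 3) → EuclideanSpace ℝ (Fin 3)) :=
    fun x => by simp [VectorCalculus.divergence]
  have heq : ∀ x, (angVelQuot W x + fderiv ℝ (angVortQuot u) x (u x)) +
      fderiv ℝ (angVortQuot u) x ((0 : EuclideanSpace ℝ (Fin 3) → EuclideanSpace ℝ (Fin 3)) x) =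
      ν * ((Δ (angVortQuot u)) x + 2 * radDerivQuot (angVortQuot u) x) +
        (-2) * (angVelQuot u x * radVelQuot (curl u) x) := fun x => by
    rw [Pi.zero_apply, map_zero, add_zero, angVelQuot_vorticityRHS_eq u ν hu hax x]
    ring
  have h := integral_cutoff_energy_le (G' := fun x => angVelQuot W x + fderiv ℝ (angVortQuot u) x (u x))
    hΩ2 hΩax hζ hζax hζc hν hR hb0 hdiv0 heq
  -- the zero-drift cut-off term vanishes, the transport term is local, the source is `B₃`
  have hz : ∫ x, ζ x * angVortQuot u x ^ 2 *
      fderiv ℝ ζ x ((0 : EuclideanSpace ℝ (Fin 3) → EuclideanSpace ℝ (Fin 3)) x) = 0 := by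
    simp
  have htr := integral_sq_mul_mul_fderiv_apply_of_divFreeOn (hζ.of_le (by norm_num)) hζc hΩ1 hv1 hdiv
  have iA : Integrable (fun x => ζ x ^ 2 * angVortQuot u x * angVelQuot W x) :=
    integrable_sq_mul_mul hζ.continuous hζc hΩ2.continuous hΩ'.continuous
  have iT : Integrable (fun x => ζ x ^ 2 * angVortQuot u x * fderiv ℝ (angVortQuot u) x (u x)) :=
    integrable_sq_mul_mul hζ.continuous hζc hΩ2.continuous
      ((hΩ2.continuous_fderiv two_ne_zero).clm_apply hu.continuous)
  have hsplit : ∫ x, ζ x ^ 2 * angVortQuot u x * (angVelQuot W x + fderiv ℝ (angVortQuot u) x (u x)) =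
      (∫ x, ζ x ^ 2 * angVortQuot u x * angVelQuot W x) +
        ∫ x, ζ x ^ 2 * angVortQuot u x * fderiv ℝ (angVortQuot u) x (u x) := by
    rw [← integral_add iA iT]
    exact integral_congr_ae (Eventually.of_forall fun x => by ring)
  have hsrc : ∫ x, ζ x ^ 2 * angVortQuot u x * ((-2) * (angVelQuot u x * radVelQuot (curl u) x)) =
      -2 * ∫ x, ζ x ^ 2 * angVortQuot u x * (angVelQuot u x * radVelQuot (curl u) x) := by
    rw [← MeasureTheory.integral_const_mul]
    exact integral_congr_ae (Eventually.of_forall fun x => by ring)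
  rw [hsplit, hz, hsrc] at h
  linarith

/-- **Seregin 2022, §2 Step 3, the localised energy inequality of `Φ = ω_r/r` at a fixed time,
for a smooth axisymmetric slice**: same setting as `angVortQuot_cutoff_energy_le_local`, with
`Φ = radVelQuot (curl u)`, `radVelQuot W` for `∂ₜΦ`, and the source `D(u_r/r)[ω]`:
`∫ ζ²Φ (radVelQuot W) + ν∫|∇(ζΦ)|² ≤ ∫ ζΦ² Dζ[u] + ν∫ Φ²|∇ζ|² − 2ν∫ ζΦ² q_ζ + ∫ ζ²Φ D(u_r/r)[ω]`.
[cite: Seregin2022LocalAxisym, §2 Step 3 (arXiv:2201.00153 p. 6, the identity for Φη⁶ with A₁, A₂, A₃)] -/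
theorem radVelQuot_curl_cutoff_energy_le_local (hu : ContDiff ℝ ∞ u) (hax : IsAxisymmetric u)
    (hν : 0 ≤ ν) (hζ : ContDiff ℝ 2 ζ) (hζax : IsAxisymmetricScalar ζ) (hζc : HasCompactSupport ζ)
    (hdiv : ∀ x, ζ x ≠ 0 → VectorCalculus.divergence u x = 0) :
    (∫ x, ζ x ^ 2 * radVelQuot (curl u) x * radVelQuot (fun y => ν • (Δ (curl u)) y -
        fderiv ℝ (curl u) y (u y) + fderiv ℝ u y (curl u y)) x) +
      ν * ∫ x, (fderiv ℝ (fun y => ζ y * radVelQuot (curl u) y) x (EuclideanSpace.single 0 1) ^ 2 +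
        fderiv ℝ (fun y => ζ y * radVelQuot (curl u) y) x (EuclideanSpace.single 1 1) ^ 2 +
        fderiv ℝ (fun y => ζ y * radVelQuot (curl u) y) x (EuclideanSpace.single 2 1) ^ 2) ≤
      (∫ x, ζ x * radVelQuot (curl u) x ^ 2 * fderiv ℝ ζ x (u x)) +
      ν * (∫ x, radVelQuot (curl u) x ^ 2 * (fderiv ℝ ζ x (EuclideanSpace.single 0 1) ^ 2 +
        fderiv ℝ ζ x (EuclideanSpace.single 1 1) ^ 2 + fderiv ℝ ζ x (EuclideanSpace.single 2 1) ^ 2)) -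
      2 * ν * (∫ x, ζ x * radVelQuot (curl u) x ^ 2 * radDerivQuot ζ x) +
      ∫ x, ζ x ^ 2 * radVelQuot (curl u) x * fderiv ℝ (radVelQuot u) x (curl u x) := by
  set W : EuclideanSpace ℝ (Fin 3) → EuclideanSpace ℝ (Fin 3) := fun y =>
    ν • (Δ (curl u)) y - fderiv ℝ (curl u) y (u y) + fderiv ℝ u y (curl u y) with hWdef
  have hv1 : ContDiff ℝ 1 u := hu.of_le (by norm_cast)
  have hv3 : ContDiff ℝ 3 u := hu.of_le (by norm_cast)
  have hvd : Differentiable ℝ u := hu.differentiable (by simp)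
  have hω : ContDiff ℝ ∞ (curl u) := contDiff_curl (n := ⊤) (by exact_mod_cast hu)
  have hω2 : ContDiff ℝ 2 (curl u) := hω.of_le (by norm_cast)
  have hω4 : ContDiff ℝ 4 (curl u) := hω.of_le (by norm_cast)
  have haxω : IsAxisymmetric (curl u) := hax.curl hvd
  have hW : ContDiff ℝ ∞ W := contDiff_vorticityRHS hu ν
  have hW3 : ContDiff ℝ 3 W := hW.of_le (by norm_cast)
  have hJ2 : ContDiff ℝ 2 (radVelQuot (curl u)) := contDiff_radVelQuot (n := 2) hω4
  have hJ1 : ContDiff ℝ 1 (radVelQuot (curl u)) := hJ2.of_le (by norm_num)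
  have hJax : IsAxisymmetricScalar (radVelQuot (curl u)) := haxω.isAxisymmetricScalar_radVelQuot hω2
  have hJ' : ContDiff ℝ 1 (radVelQuot W) := contDiff_radVelQuot (n := 1) hW3
  have hWr : ContDiff ℝ 1 (radVelQuot u) := contDiff_radVelQuot (n := 1) hv3
  have hR : Continuous fun x => fderiv ℝ (radVelQuot u) x (curl u x) :=
    (hWr.continuous_fderiv one_ne_zero).clm_apply hω.continuous
  have hb0 : ContDiff ℝ 1 (0 : EuclideanSpace ℝ (Fin 3) → EuclideanSpace ℝ (Fin 3)) := contDiff_const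
  have hdiv0 : VectorCalculus.IsDivFree (0 : EuclideanSpace ℝ (Fin 3) → EuclideanSpace ℝ (Fin 3)) :=
    fun x => by simp [VectorCalculus.divergence]
  have heq : ∀ x, (radVelQuot W x + fderiv ℝ (radVelQuot (curl u)) x (u x)) +
      fderiv ℝ (radVelQuot (curl u)) x ((0 : EuclideanSpace ℝ (Fin 3) → EuclideanSpace ℝ (Fin 3)) x) =
      ν * ((Δ (radVelQuot (curl u))) x + 2 * radDerivQuot (radVelQuot (curl u)) x) +
        fderiv ℝ (radVelQuot u) x (curl u x) := fun x => by
    rw [Pi.zero_apply, map_zero, add_zero, radVelQuot_vorticityRHS_eq u ν hu hax x]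
  have h := integral_cutoff_energy_le (G' := fun x => radVelQuot W x + fderiv ℝ (radVelQuot (curl u)) x (u x))
    hJ2 hJax hζ hζax hζc hν hR hb0 hdiv0 heq
  have hz : ∫ x, ζ x * radVelQuot (curl u) x ^ 2 *
      fderiv ℝ ζ x ((0 : EuclideanSpace ℝ (Fin 3) → EuclideanSpace ℝ (Fin 3)) x) = 0 := by
    simp
  have htr := integral_sq_mul_mul_fderiv_apply_of_divFreeOn (hζ.of_le (by norm_num)) hζc hJ1 hv1 hdiv
  have iA : Integrable (fun x => ζ x ^ 2 * radVelQuot (curl u) x * radVelQuot W x) :=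
    integrable_sq_mul_mul hζ.continuous hζc hJ2.continuous hJ'.continuous
  have iT : Integrable (fun x => ζ x ^ 2 * radVelQuot (curl u) x *
      fderiv ℝ (radVelQuot (curl u)) x (u x)) :=
    integrable_sq_mul_mul hζ.continuous hζc hJ2.continuous
      ((hJ2.continuous_fderiv two_ne_zero).clm_apply hu.continuous)
  have hsplit : ∫ x, ζ x ^ 2 * radVelQuot (curl u) x *
      (radVelQuot W x + fderiv ℝ (radVelQuot (curl u)) x (u x)) =
      (∫ x, ζ x ^ 2 * radVelQuot (curl u) x * radVelQuot W x) +
        ∫ x, ζ x ^ 2 * radVelQuot (curl u) x * fderiv ℝ (radVelQuot (curl u)) x (u x) := by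
    rw [← integral_add iA iT]
    exact integral_congr_ae (Eventually.of_forall fun x => by ring)
  rw [hsplit, hz] at h
  linarith

end FixedTime

end Summit.NavierStokesRegularity.NavierStokesRegularity.Theorems.AxisymmetricKatoGlobal.EulerScaling

end
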